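import Mathlib
import HarnessLib
import Summits.RiemannHypothesis.RiemannHypothesis.Theses.SmoothSectorHardy

/-!
# Route `SmoothSectorHardy` — the Assembly item (provable now; rev 2 of the route: K1a with the MellinConvergent proviso, K1b takes K1a globally)

`theorem assembly_holds : Summit.RiemannHypothesis.RiemannHypothesis.Theses.SmoothSectorHardy.Assembly`
(item stmt-RiemannHypothesis-21568): `ProfileMellinFormula → ProfileParsevalFE → HardyThreePointBound →
ScrewSmoothSectorKSharp`, pure real arithmetic — K1b (fed by K1a) gives ∫₀¹(h−h₀)²/y² + h₀² = (8π³)⁻¹·X, K2 gives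
X ≥ 2π⁵g(0)² when X's integrand is integrable (else the Bochner value X = 0 forces h₀ = 0), and h₀ = −g(0)/2 is
`rfl`. [folklore] Nothing here bears on the truth of RH. -/

set_option linter.dupNamespace false

noncomputable section

namespace Summit.RiemannHypothesis.RiemannHypothesis.Theorems.SmoothSectorHardy

open MeasureTheory Set Complex
open Summit.RiemannHypothesis.RiemannHypothesis.Theorems.IntegerScrew
open Summit.RiemannHypothesis.RiemannHypothesis.Theses.SmoothSectorHardy

/-- The Assembly item of route `SmoothSectorHardy` (stmt-RiemannHypothesis-21568). [folklore] -/
theorem assembly_holds :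
    Summit.RiemannHypothesis.RiemannHypothesis.Theses.SmoothSectorHardy.Assembly := by
  intro h1a h1b h2 g hg hint
  have hid := h1b h1a g hg hint
  have hA0 : 0 ≤ ∫ y in Set.Ioo (0:ℝ) 1, (latticeProfile g y - latticePlateau g) ^ 2 / y ^ 2 :=
    setIntegral_nonneg measurableSet_Ioo (fun y _ => div_nonneg (sq_nonneg _) (sq_nonneg _))
  have hp : latticePlateau g = -(g 0) / 2 := rfl
  have hpi : 0 < Real.pi := Real.pi_pos
  have hpi3 : Real.pi > 3 := Real.pi_gt_three
  by_cases hI : Integrable (fun t : ℝ =>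
      ‖∫ u in Set.Ioo (0:ℝ) 1, ((deriv g u : ℝ) : ℂ) * (u : ℂ) ^ (-(1 / 2 : ℂ) + t * I)‖ ^ 2
        * ‖riemannZeta (3 / 2 + t * I)‖ ^ 2)
  · have h2' := h2 g hg hI
    have hc : 0 ≤ 1 / (8 * Real.pi ^ 3) := by positivity
    have hmul := mul_le_mul_of_nonneg_left h2' hc
    have h3 : (1 / (8 * Real.pi ^ 3)) * (2 * Real.pi ^ 5 * (g 0) ^ 2) = Real.pi ^ 2 * (g 0) ^ 2 / 4 := by
      field_simp
      ring
    rw [hp] at hid ⊢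
    nlinarith [hmul, h3, hid, sq_nonneg (g 0)]
  · have hX0 := integral_undef hI
    rw [hX0, mul_zero] at hid
    have hsq : latticePlateau g ^ 2 = 0 := by nlinarith [sq_nonneg (latticePlateau g)]
    rw [hsq, mul_zero]
    exact hA0

end Summit.RiemannHypothesis.RiemannHypothesis.Theorems.SmoothSectorHardy

end
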